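import Literature.MathematicalPhysics.QuantumLattice.TorusSectorPartitionFnMixtureTiling
import Literature.MathematicalPhysics.QuantumLattice.TorusSectorGibbsOpenBoxBound
import HarnessLib

/-!
# The type-class product trial state: a certified LOWER bound on the canonical (sector) pressure of the
# torus from open-box canonical partition functions and a type (method of types)

Family `hubbard` (topic `MathematicalPhysics/QuantumLattice`). Kernel form of the certificate C2 of the
`hubbard-thermal` free-energy programme: on a torus tiled by `K` open boxes put `k_s` boxes in the sector `s`
(a TYPE `k`, `Σ k_s = K`); the uniform mixture over the `multinomial(k)` assignments of this type (and the
canonical Gibbs mixture inside each box) is a trial state of the torus sector `Σ_s k_s • s`, whence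
`multinomial(k) · Π_s Z_box(s)^{k_s} ≤ Z_torus(Σ k_s • s)` — entropy of mixing PLUS the box free energies.
* §1 `le_coeff_pow_of_type` — the type term of a convolution power in `ℝ[ℕ × ℕ]` (multinomial theorem);
* §2 the METHOD OF TYPES in `ℕ`: `pow_mul_factorial_le` (`k^{k'} k! ≤ k^k k'!`), `multinomial_mul_prod_pow_le`
  (the mean type is the mode), `pow_le_card_mul_multinomial_mul_prod_pow` (`K^K ≤ #types·multinomial(k)·Π k_s^{k_s}`),
  `card_piAntidiag_le` (`#types ≤ (K+1)^{|S|}`), log form `typeEntropy_sub_le_log_multinomial`: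
  `K log K − Σ_s k_s log k_s − |S| log(K+1) ≤ log multinomial(k)` [cite: CoverThomas2006, Theorem 11.1.3];
* §3 FINITE VOLUME `multinomial_mul_prod_pow_le_partitionFn_rectTorus` (`t–t'` torus `ℤ/K_x aℤ × ℤ/K_y bℤ`,
  `K_x, K_y ≥ 2`, `β ≥ 0`, box data `0 ≤ z_s ≤ Re Z_β(H^open_{a×b}; s)`, type `k` of size `K_x K_y`):
  `multinomial(k) · Π_s z_s^{k_s} ≤ Re Z_β(H^torus; Σ_s k_s a_s, Σ_s k_s b_s)`; log form with the types bound
  `typeFreeEntropy_le_log_partitionFn_rectTorus`;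
* §4 THERMODYNAMIC LIMIT `eventually_typeFreeEntropy_mul_sq_le_log_partitionFn`: along tori `L_j = K_x a = K_y b`
  carrying `R_j` copies of a balanced base type `m` (`Σ m_s = q`, sector `halfRectN n L_j = R_j Σ m_s a_s`),
  for every `ε > 0` eventually `(W − ε) L_j² ≤ log Re Z_β(sectorHamiltonianTT' t t' U n L_j)`,
  `W = (q log q − Σ_s m_s log m_s + Σ_s m_s log z_s)/(q a b)` — the hypothesis `hℓ` of the chord theorems of
  `TorusSectorGibbsEnergyWindow.lean` (a certified LOWER bound on the sector pressure).
[cite: Ruelle1969, §3.3] [cite: Israel1979, Lemma II.3.1]. Everything is PROVED; no definition, no named fact.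
-/

noncomputable section

namespace Literature.MathematicalPhysics.QuantumLattice

open Matrix Finset HubbardWave0 ThermodynamicLimit LiebThm1 AddMonoidAlgebra Literature.Probability.LatticeModels
open _root_.Filter
open scoped _root_.Topology ComplexOrder BigOperators

/-! ### §1 The type term of a convolution power -/

section TypeTerm

variable {σ : Type*} [DecidableEq σ]

/-- **The type term of a convolution power.** For `P = Σ_{s ∈ S} z_s X^{w(s)} ∈ ℝ[ℕ × ℕ]` with `z ≥ 0` on `S`
and a type `k ∈ piAntidiag S K` (`Σ_{s∈S} k_s = K`):
`multinomial(k) · Π_{s∈S} z_s^{k_s} ≤ (P^K)(Σ_{s∈S} k_s • w(s))` — expand `P^K` by the multinomial theorem;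
every type contributes a nonnegative amount to every coefficient. [cite: Ruelle1969, §3.3] -/
theorem le_coeff_pow_of_type (S : Finset σ) (w : σ → ℕ × ℕ) (z : σ → ℝ) (hz : ∀ s ∈ S, 0 ≤ z s)
    {K : ℕ} {k : σ → ℕ} (hk : k ∈ S.piAntidiag K) :
    (Nat.multinomial S k : ℝ) * ∏ s ∈ S, z s ^ k s ≤
      ((∑ s ∈ S, single (w s) (z s)) ^ K).coeff (∑ s ∈ S, k s • w s) := by
  classical
  rw [Finset.sum_pow_eq_sum_piAntidiag, coeff_sum, Finset.sum_apply']
  have hterm : ∀ k' : σ → ℕ, ((Nat.multinomial S k' : AddMonoidAlgebra ℝ (ℕ × ℕ)) *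
      ∏ s ∈ S, single (w s) (z s) ^ k' s).coeff (∑ s ∈ S, k s • w s) =
      if (∑ s ∈ S, k' s • w s) = ∑ s ∈ S, k s • w s then (Nat.multinomial S k' : ℝ) * ∏ s ∈ S, z s ^ k' s
        else 0 := by
    intro k'
    simp_rw [single_pow]
    rw [prod_single, natCast_def, single_mul_single, zero_add, coeff_single, Finsupp.single_apply]
  simp_rw [hterm]
  refine le_trans (le_of_eq (by rw [if_pos rfl])) (Finset.single_le_sum (f := fun k' : σ → ℕ =>
    if (∑ s ∈ S, k' s • w s) = ∑ s ∈ S, k s • w s then (Nat.multinomial S k' : ℝ) * ∏ s ∈ S, z s ^ k' s else 0)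
    (fun k' _ => ?_) hk)
  split_ifs
  · exact mul_nonneg (Nat.cast_nonneg _) (Finset.prod_nonneg fun s hs => pow_nonneg (hz s hs) _)
  · exact le_rfl

end TypeTerm

/-! ### §2 The method of types: `multinomial(k) ≥ (K+1)^{-|S|} · exp(K·H(k/K))` -/

section Types

/-- `k^{k'} · k! ≤ k^k · k'!` for all naturals `k, k'` (the mode of the multinomial distribution is its
mean type). [cite: CoverThomas2006, Theorem 11.1.3] -/
theorem pow_mul_factorial_le (k k' : ℕ) : k ^ k' * k.factorial ≤ k ^ k * k'.factorial := by
  rcases le_or_gt k' k with h | h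
  · -- `k' ≤ k`: `k! = k'! · k(k-1)⋯(k'+1) ≤ k'! · k^{k−k'}`
    obtain ⟨n, rfl⟩ := Nat.exists_eq_add_of_le h
    have h1 : (k' + n).factorial = k'.factorial * (k' + n).descFactorial n := by
      rw [← Nat.factorial_mul_descFactorial (Nat.le_add_left n k'), Nat.add_sub_cancel]
    have h2 : (k' + n).descFactorial n ≤ (k' + n) ^ n := Nat.descFactorial_le_pow _ _
    calc (k' + n) ^ k' * (k' + n).factorial
        = (k' + n) ^ k' * (k'.factorial * (k' + n).descFactorial n) := by rw [h1]
      _ ≤ (k' + n) ^ k' * (k'.factorial * (k' + n) ^ n) :=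
          Nat.mul_le_mul_left _ (Nat.mul_le_mul_left _ h2)
      _ = (k' + n) ^ (k' + n) * k'.factorial := by rw [pow_add]; ring
  · -- `k < k'`: `k'! = k! · (k+1)⋯k' ≥ k! · k^{k'−k}`
    obtain ⟨n, rfl⟩ := Nat.exists_eq_add_of_lt h
    have h1 : k.factorial * (k + 1) ^ (n + 1) ≤ (k + (n + 1)).factorial := Nat.factorial_mul_pow_le_factorial
    have h2 : k ^ (n + 1) ≤ (k + 1) ^ (n + 1) := Nat.pow_le_pow_left (Nat.le_succ k) _
    calc k ^ (k + n + 1) * k.factorial = k ^ k * (k.factorial * k ^ (n + 1)) := by rw [pow_add, ← pow_add]; ring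
      _ ≤ k ^ k * (k.factorial * (k + 1) ^ (n + 1)) := Nat.mul_le_mul_left _ (Nat.mul_le_mul_left _ h2)
      _ ≤ k ^ k * (k + (n + 1)).factorial := Nat.mul_le_mul_left _ h1
      _ = k ^ k * (k + n + 1).factorial := by rw [add_assoc]

variable {σ : Type*} [DecidableEq σ]

/-- **The mean type is the mode**: for types `k, k'` of the same size on `S`,
`multinomial(k') · Π_s k_s^{k'_s} ≤ multinomial(k) · Π_s k_s^{k_s}`. [cite: CoverThomas2006, Theorem 11.1.3] -/
theorem multinomial_mul_prod_pow_le (S : Finset σ) {K : ℕ} {k k' : σ → ℕ} (hk : k ∈ S.piAntidiag K)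
    (hk' : k' ∈ S.piAntidiag K) :
    Nat.multinomial S k' * ∏ s ∈ S, k s ^ k' s ≤ Nat.multinomial S k * ∏ s ∈ S, k s ^ k s := by
  have hK : ∑ s ∈ S, k s = K := (Finset.mem_piAntidiag.1 hk).1
  have hK' : ∑ s ∈ S, k' s = K := (Finset.mem_piAntidiag.1 hk').1
  -- multiply through by the positive `(Π k'_s!) (Π k_s!)`
  have hpos : 0 < (∏ s ∈ S, (k' s).factorial) * ∏ s ∈ S, (k s).factorial :=
    Nat.mul_pos (Finset.prod_pos fun s _ => Nat.factorial_pos _) (Finset.prod_pos fun s _ => Nat.factorial_pos _)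
  refine Nat.le_of_mul_le_mul_left ?_ hpos
  have e1 : (∏ s ∈ S, (k' s).factorial) * (∏ s ∈ S, (k s).factorial) * (Nat.multinomial S k' * ∏ s ∈ S, k s ^ k' s)
      = K.factorial * ∏ s ∈ S, ((k s).factorial * k s ^ k' s) := by
    rw [Finset.prod_mul_distrib, ← hK', ← Nat.multinomial_spec S k']
    ring
  have e2 : (∏ s ∈ S, (k' s).factorial) * (∏ s ∈ S, (k s).factorial) * (Nat.multinomial S k * ∏ s ∈ S, k s ^ k s)
      = K.factorial * ∏ s ∈ S, ((k' s).factorial * k s ^ k s) := by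
    rw [Finset.prod_mul_distrib, ← hK, ← Nat.multinomial_spec S k]
    ring
  rw [e1, e2]
  refine Nat.mul_le_mul_left _ (Finset.prod_le_prod' fun s _ => ?_)
  have := pow_mul_factorial_le (k s) (k' s)
  rw [mul_comm, mul_comm ((k' s).factorial)]
  exact this

/-- **The method of types, in `ℕ`:** `K^K ≤ #(piAntidiag S K) · multinomial(k) · Π_s k_s^{k_s}` for every type
`k` of size `K` on `S` (multinomial expansion of `(Σ_s k_s)^K`, each term bounded by the mode).
[cite: CoverThomas2006, Theorem 11.1.3] -/
theorem pow_le_card_mul_multinomial_mul_prod_pow (S : Finset σ) {K : ℕ} {k : σ → ℕ}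
    (hk : k ∈ S.piAntidiag K) :
    K ^ K ≤ (S.piAntidiag K).card * (Nat.multinomial S k * ∏ s ∈ S, k s ^ k s) := by
  have hK : ∑ s ∈ S, k s = K := (Finset.mem_piAntidiag.1 hk).1
  conv_lhs => rw [← hK, Finset.sum_pow_eq_sum_piAntidiag, hK]
  rw [← smul_eq_mul, ← Finset.sum_const]
  exact Finset.sum_le_sum fun k' hk' => multinomial_mul_prod_pow_le S hk hk'

/-- **There are at most `(K+1)^{|S|}` types of size `K` on `S`.** [cite: CoverThomas2006, Theorem 11.1.1] -/
theorem card_piAntidiag_le (S : Finset σ) (K : ℕ) : (S.piAntidiag K).card ≤ (K + 1) ^ S.card := by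
  classical
  have hcard : (Fintype.piFinset fun _ : ↥S => Finset.range (K + 1)).card = (K + 1) ^ S.card := by
    rw [Fintype.card_piFinset, Finset.prod_const, Finset.card_range, Finset.card_univ, Fintype.card_coe]
  rw [← hcard]
  refine Finset.card_le_card_of_injOn (fun k s => k s.1) (fun k hk => ?_) (fun k hk k' hk' h => ?_)
  · rw [Finset.mem_coe, Fintype.mem_piFinset]
    intro s
    have hsum := (Finset.mem_piAntidiag.1 (Finset.mem_coe.1 hk)).1
    have hle : k s.1 ≤ K := by
      rw [← hsum]
      exact Finset.single_le_sum (f := k) (fun _ _ => Nat.zero_le _) s.2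
    refine Finset.mem_range.2 ?_
    show k s.1 < K + 1
    omega
  · have hk1 := (Finset.mem_piAntidiag.1 (Finset.mem_coe.1 hk)).2
    have hk'1 := (Finset.mem_piAntidiag.1 (Finset.mem_coe.1 hk')).2
    funext s
    by_cases hs : s ∈ S
    · exact congrFun h ⟨s, hs⟩
    · have h1 : k s = 0 := by
        by_contra h0
        exact hs (hk1 s h0)
      have h2 : k' s = 0 := by
        by_contra h0
        exact hs (hk'1 s h0)
      rw [h1, h2]

/-- **The method of types, logarithmic form:** for a type `k` of size `K ≥ 1` on `S`,
`K log K − Σ_{s∈S} k_s log k_s − |S| log (K+1) ≤ log multinomial(k)` — i.e.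
`multinomial(k) ≥ (K+1)^{-|S|} e^{K H(k/K)}` with `H` the Shannon entropy of the type's frequencies.
[cite: CoverThomas2006, Theorem 11.1.3] -/
theorem typeEntropy_sub_le_log_multinomial (S : Finset σ) {K : ℕ} (hK : 1 ≤ K) {k : σ → ℕ}
    (hk : k ∈ S.piAntidiag K) :
    (K : ℝ) * Real.log K - ∑ s ∈ S, (k s : ℝ) * Real.log (k s) - S.card * Real.log (K + 1) ≤
      Real.log (Nat.multinomial S k) := by
  have h := pow_le_card_mul_multinomial_mul_prod_pow S hk
  have hcard := card_piAntidiag_le S K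
  -- cast to `ℝ` and take logarithms
  have hKpos : (0 : ℝ) < K := by exact_mod_cast hK
  have hmult : (0 : ℝ) < Nat.multinomial S k := by exact_mod_cast Nat.multinomial_pos S k
  have hprod : (0 : ℝ) < ∏ s ∈ S, ((k s : ℝ) ^ k s) := by
    refine Finset.prod_pos fun s _ => ?_
    rcases Nat.eq_zero_or_pos (k s) with h0 | h0
    · rw [h0, pow_zero]; exact one_pos
    · exact pow_pos (by exact_mod_cast h0) _
  have hcardpos : (0 : ℝ) < (S.piAntidiag K).card := by
    have : 0 < (S.piAntidiag K).card := Finset.card_pos.2 ⟨k, hk⟩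
    exact_mod_cast this
  have hR : ((K : ℝ) ^ K) ≤ ((S.piAntidiag K).card : ℝ) * ((Nat.multinomial S k : ℝ) * ∏ s ∈ S, ((k s : ℝ) ^ k s)) := by
    exact_mod_cast h
  have hlog := Real.log_le_log (pow_pos hKpos K) hR
  rw [Real.log_pow, Real.log_mul hcardpos.ne' (mul_pos hmult hprod).ne', Real.log_mul hmult.ne' hprod.ne',
    Real.log_prod (fun s _ => by
      rcases Nat.eq_zero_or_pos (k s) with h0 | h0
      · rw [h0, pow_zero]; exact one_ne_zero
      · exact (pow_pos (by exact_mod_cast h0) _).ne')] at hlog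
  rw [Finset.sum_congr rfl fun s _ => Real.log_pow _ _] at hlog
  have hlogcard : Real.log ((S.piAntidiag K).card : ℝ) ≤ S.card * Real.log (K + 1) := by
    have h1 : ((S.piAntidiag K).card : ℝ) ≤ ((K + 1 : ℕ) : ℝ) ^ S.card := by exact_mod_cast hcard
    have h2 := Real.log_le_log hcardpos h1
    rw [Real.log_pow] at h2
    push_cast at h2
    exact h2
  linarith

end Types

/-! ### §3 Finite volume: the type-class trial state on the torus -/

section Torus

/-- **Finite-volume C2 bound** (`t–t'` torus `ℤ/K_x aℤ × ℤ/K_y bℤ`, `K_x, K_y ≥ 2`, `β ≥ 0`, box data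
`0 ≤ z_s ≤ Re Z_β(H^open_{a×b}; s)` on a finite set `S` of sectors, type `k` of size `K_x K_y` on `S`):
`multinomial(k) · Π_s z_s^{k_s} ≤ Re Z_β(H^torus; Σ_s k_s a_s, Σ_s k_s b_s)`. [cite: Ruelle1969, §3.3] -/
theorem multinomial_mul_prod_pow_le_partitionFn_rectTorus (a b Kx Ky : ℕ) (hKx : 2 ≤ Kx) (hKy : 2 ≤ Ky)
    (t t' U : ℝ) {β : ℝ} (hβ : 0 ≤ β) (S : Finset (ℕ × ℕ)) {z : ℕ × ℕ → ℝ} (hz0 : ∀ s ∈ S, 0 ≤ z s)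
    (hz : ∀ s ∈ S, z s ≤ (partitionFn β (spinSectorHamiltonian s.1 s.2 (hubbardOpenBoxTT' a b t t' U))).re)
    {k : ℕ × ℕ → ℕ} (hk : k ∈ S.piAntidiag (Kx * Ky)) :
    (Nat.multinomial S k : ℝ) * ∏ s ∈ S, z s ^ k s ≤
      (partitionFn β (spinSectorHamiltonian (∑ s ∈ S, k s * s.1) (∑ s ∈ S, k s * s.2)
        (hubbardRectTorusTT' (Kx * a) (Ky * b) t t' U))).re := by
  classical
  set P : AddMonoidAlgebra ℝ (ℕ × ℕ) := ∑ s ∈ S, single s (z s) with hPdef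
  have hPcoeff : ∀ m : ℕ × ℕ, P.coeff m = if m ∈ S then z m else 0 := by
    intro m
    rw [hPdef, coeff_sum, Finset.sum_apply']
    simp_rw [coeff_single, Finsupp.single_apply]
    rw [Finset.sum_ite_eq' S m]
  have hP0 : ∀ m, 0 ≤ P.coeff m := by
    intro m
    rw [hPcoeff]
    split_ifs with hm
    · exact hz0 m hm
    · exact le_rfl
  have hPle : ∀ c d, P.coeff (c, d) ≤
      (partitionFn β (spinSectorHamiltonian c d (hubbardOpenBoxTT' a b t t' U))).re := by
    intro c d
    rw [hPcoeff]
    split_ifs with hm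
    · exact hz (c, d) hm
    · exact partitionFn_spinSector_re_nonneg _ _ (hubbardOpenBoxTT'_isHermitian a b t t' U) β
  have htarget : (∑ s ∈ S, k s • (s : ℕ × ℕ)) = (∑ s ∈ S, k s * s.1, ∑ s ∈ S, k s * s.2) := by
    refine Prod.ext ?_ ?_
    · rw [Prod.fst_sum]; rfl
    · rw [Prod.snd_sum]; rfl
  have h1 := le_coeff_pow_of_type S (fun s => s) z hz0 hk
  rw [htarget] at h1
  exact h1.trans (coeff_pow_le_partitionFn_rectTorus a b Kx Ky hKx hKy t t' U hβ P hP0 hPle _ _)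

/-- **Finite-volume C2 bound, free-entropy form.** In the setting of
`multinomial_mul_prod_pow_le_partitionFn_rectTorus` with `z_s > 0` and `K = K_x K_y ≥ 1`:
`K log K − Σ_s k_s log k_s + Σ_s k_s log z_s − |S| log(K+1) ≤ log Re Z_β(H^torus; Σ k_s a_s, Σ k_s b_s)`.
[cite: Ruelle1969, §3.3] [cite: CoverThomas2006, Theorem 11.1.3] -/
theorem typeFreeEntropy_le_log_partitionFn_rectTorus (a b Kx Ky : ℕ) (hKx : 2 ≤ Kx) (hKy : 2 ≤ Ky)
    (t t' U : ℝ) {β : ℝ} (hβ : 0 ≤ β) (S : Finset (ℕ × ℕ)) {z : ℕ × ℕ → ℝ} (hz0 : ∀ s ∈ S, 0 < z s)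
    (hz : ∀ s ∈ S, z s ≤ (partitionFn β (spinSectorHamiltonian s.1 s.2 (hubbardOpenBoxTT' a b t t' U))).re)
    {k : ℕ × ℕ → ℕ} (hk : k ∈ S.piAntidiag (Kx * Ky)) :
    ((Kx * Ky : ℕ) : ℝ) * Real.log ((Kx * Ky : ℕ) : ℝ) - ∑ s ∈ S, (k s : ℝ) * Real.log (k s) +
        ∑ s ∈ S, (k s : ℝ) * Real.log (z s) - S.card * Real.log ((Kx * Ky : ℕ) + 1) ≤
      Real.log (partitionFn β (spinSectorHamiltonian (∑ s ∈ S, k s * s.1) (∑ s ∈ S, k s * s.2)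
        (hubbardRectTorusTT' (Kx * a) (Ky * b) t t' U))).re := by
  have hK : 1 ≤ Kx * Ky := Nat.one_le_iff_ne_zero.2 (Nat.mul_ne_zero (by omega) (by omega))
  have h1 := multinomial_mul_prod_pow_le_partitionFn_rectTorus a b Kx Ky hKx hKy t t' U hβ S
    (fun s hs => (hz0 s hs).le) hz hk
  have h2 := typeEntropy_sub_le_log_multinomial S hK hk
  have hmult : (0 : ℝ) < Nat.multinomial S k := by exact_mod_cast Nat.multinomial_pos S k
  have hprod : (0 : ℝ) < ∏ s ∈ S, z s ^ k s := Finset.prod_pos fun s hs => pow_pos (hz0 s hs) _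
  have hlog := Real.log_le_log (mul_pos hmult hprod) h1
  rw [Real.log_mul hmult.ne' hprod.ne', Real.log_prod (fun s hs => (pow_pos (hz0 s hs) _).ne')] at hlog
  rw [Finset.sum_congr rfl fun s _ => Real.log_pow _ _] at hlog
  linarith

end Torus

/-! ### §4 Thermodynamic limit: the certified lower bound on the sector pressure -/

namespace InfVolFermionState

variable {t t' U n : ℝ} {Ls : ℕ → ℕ}

/-- **Scaling of the type entropy**: for the `R`-fold type `R • m` (`Σ_s m_s = q`),
`(Rq) log(Rq) − Σ_s (R m_s) log(R m_s) = R · (q log q − Σ_s m_s log m_s)`. [cite: CoverThomas2006, Theorem 11.1.3] -/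
theorem typeEntropy_smul (S : Finset (ℕ × ℕ)) (m : ℕ × ℕ → ℕ) {q : ℕ} (hq : ∑ s ∈ S, m s = q) (R : ℕ) :
    ((R * q : ℕ) : ℝ) * Real.log ((R * q : ℕ) : ℝ) - ∑ s ∈ S, ((R * m s : ℕ) : ℝ) * Real.log ((R * m s : ℕ) : ℝ) =
      (R : ℝ) * ((q : ℝ) * Real.log q - ∑ s ∈ S, (m s : ℝ) * Real.log (m s)) := by
  rcases Nat.eq_zero_or_pos R with hR | hR
  · subst hR; simp
  have hRr : (0 : ℝ) < R := by exact_mod_cast hR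
  -- `log(R x) = log R + log x` for `x > 0`; the `x = 0` terms vanish on both sides
  have hterm : ∀ x : ℕ, ((R * x : ℕ) : ℝ) * Real.log ((R * x : ℕ) : ℝ) =
      (R : ℝ) * ((x : ℝ) * Real.log R + (x : ℝ) * Real.log x) := by
    intro x
    rcases Nat.eq_zero_or_pos x with hx | hx
    · subst hx; simp
    · have hxr : (0 : ℝ) < x := by exact_mod_cast hx
      push_cast
      rw [Real.log_mul hRr.ne' hxr.ne']
      ring
  rw [hterm q]
  simp_rw [hterm]
  rw [← Finset.mul_sum, Finset.sum_add_distrib, ← Finset.sum_mul, ← Nat.cast_sum, hq]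
  ring

/-- **The certified LOWER bound on the sector pressure in the thermodynamic limit (certificate C2).**
Box `a × b` (`a, b ≥ 1`); a finite set `S` of box sectors with a balanced base type `m` (`Σ_s m_s = q ≥ 1`,
`Σ_s m_s a_s = Σ_s m_s b_s = A₀`); certified box data `0 < z_s ≤ Re Z_β(H^open_{a×b}(t,t',U); s)` (`β ≥ 0`);
tori eventually of the form `Ls j = K_x a = K_y b`, `K_x, K_y ≥ 2`, `K_x K_y = R q`, `halfRectN n (Ls j) = R A₀`.
Then for every `ε > 0`, eventually `(W − ε) (Ls j)² ≤ log Re Z_β(sectorHamiltonianTT' t t' U n (Ls j))`,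
`W = (q log q − Σ_s m_s log m_s + Σ_s m_s log z_s)/(q a b)` — the hypothesis `hℓ` of the chord theorems.
[cite: Ruelle1969, §3.3] [cite: Israel1979, Lemma II.3.1] [cite: CoverThomas2006, Theorem 11.1.3] -/
theorem eventually_typeFreeEntropy_mul_sq_le_log_partitionFn (t t' U n : ℝ) {β : ℝ} (hβ : 0 ≤ β)
    {a b : ℕ} (ha : 1 ≤ a) (hb : 1 ≤ b) (S : Finset (ℕ × ℕ)) (m : ℕ × ℕ → ℕ) {q A₀ : ℕ} (hq : 1 ≤ q)
    (hmS : ∀ s, m s ≠ 0 → s ∈ S) (hsum : ∑ s ∈ S, m s = q) (hA : ∑ s ∈ S, m s * s.1 = A₀)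
    (hB : ∑ s ∈ S, m s * s.2 = A₀) {z : ℕ × ℕ → ℝ} (hz0 : ∀ s ∈ S, 0 < z s)
    (hz : ∀ s ∈ S, z s ≤ (partitionFn β (spinSectorHamiltonian s.1 s.2 (hubbardOpenBoxTT' a b t t' U))).re)
    (hbox : ∀ᶠ j in atTop, ∃ R Kx Ky : ℕ, 2 ≤ Kx ∧ 2 ≤ Ky ∧ Ls j = Kx * a ∧ Ls j = Ky * b ∧
      Kx * Ky = R * q ∧ halfRectN n (Ls j) = R * A₀)
    (hLs : Tendsto Ls atTop atTop) {ε : ℝ} (hε : 0 < ε) :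
    ∀ᶠ j in atTop, (((q : ℝ) * Real.log q - ∑ s ∈ S, (m s : ℝ) * Real.log (m s) +
        ∑ s ∈ S, (m s : ℝ) * Real.log (z s)) / ((q : ℝ) * a * b) - ε) * (Ls j : ℝ) ^ 2 ≤
      Real.log (partitionFn β (sectorHamiltonianTT' t t' U n (Ls j))).re := by
  -- the error term `|S| log(L² + 1) ≤ ε L²` eventually (`log x = o(x)`)
  have hev : ∀ᶠ j in atTop, (S.card : ℝ) * Real.log ((Ls j : ℝ) ^ 2 + 1) ≤ ε * (Ls j : ℝ) ^ 2 := by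
    have h2 : Tendsto (fun j => (Ls j : ℝ) ^ 2 + 1) atTop atTop := tendsto_atTop_add_const_right _ 1
      ((tendsto_pow_atTop two_ne_zero).comp (tendsto_natCast_atTop_atTop.comp hLs))
    set c : ℝ := ε / (2 * S.card + 1) with hc
    have hcpos : 0 < c := by positivity
    have h3 := h2.eventually (Real.isLittleO_log_id_atTop.def hcpos)
    filter_upwards [h3, hLs.eventually_ge_atTop 1] with j hj hj1
    have hL1 : (1 : ℝ) ≤ (Ls j : ℝ) ^ 2 := by nlinarith [show (1 : ℝ) ≤ Ls j by exact_mod_cast hj1]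
    have hpos : 0 < (Ls j : ℝ) ^ 2 + 1 := by positivity
    have hlogle : Real.log ((Ls j : ℝ) ^ 2 + 1) ≤ c * ((Ls j : ℝ) ^ 2 + 1) := by
      rwa [id, Real.norm_eq_abs, Real.norm_eq_abs, abs_of_nonneg (Real.log_nonneg (by linarith)),
        abs_of_pos hpos] at hj
    have hS : (0 : ℝ) ≤ S.card := Nat.cast_nonneg _
    have h5 : (S.card : ℝ) * ((Ls j : ℝ) ^ 2 + 1) ≤ (2 * S.card + 1) * (Ls j : ℝ) ^ 2 := by nlinarith
    calc (S.card : ℝ) * Real.log ((Ls j : ℝ) ^ 2 + 1) ≤ S.card * (c * ((Ls j : ℝ) ^ 2 + 1)) :=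
          mul_le_mul_of_nonneg_left hlogle hS
      _ = c * ((S.card : ℝ) * ((Ls j : ℝ) ^ 2 + 1)) := by ring
      _ ≤ c * ((2 * S.card + 1) * (Ls j : ℝ) ^ 2) := mul_le_mul_of_nonneg_left h5 hcpos.le
      _ = ε * (Ls j : ℝ) ^ 2 := by
          rw [hc]
          field_simp
  filter_upwards [hbox, hev] with j hj hjε
  obtain ⟨R, Kx, Ky, hKx, hKy, hLx, hLy, hK, hsec⟩ := hj
  -- the finite-volume bound for the type `R • m`
  have hk : (fun s => R * m s) ∈ S.piAntidiag (Kx * Ky) := by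
    rw [Finset.mem_piAntidiag]
    refine ⟨?_, fun s hs => hmS s (fun h0 => hs (by rw [h0, mul_zero]))⟩
    rw [← Finset.mul_sum, hsum, hK]
  have hfin := typeFreeEntropy_le_log_partitionFn_rectTorus a b Kx Ky hKx hKy t t' U hβ S hz0 hz hk
  -- identify the torus sector partition function with the sector compression of the square torus
  have hA' : (∑ s ∈ S, R * m s * s.1) = R * A₀ := by
    rw [← hA, Finset.mul_sum]; exact Finset.sum_congr rfl fun s _ => by ring
  have hB' : (∑ s ∈ S, R * m s * s.2) = R * A₀ := by
    rw [← hB, Finset.mul_sum]; exact Finset.sum_congr rfl fun s _ => by ring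
  rw [hA', hB', ← hsec] at hfin
  have hsq : Real.log (partitionFn β (spinSectorHamiltonian (halfRectN n (Ls j)) (halfRectN n (Ls j))
      (hubbardRectTorusTT' (Kx * a) (Ky * b) t t' U))).re =
      Real.log (partitionFn β (sectorHamiltonianTT' t t' U n (Ls j))).re := by
    rw [partitionFn_sectorHamiltonianTT'_eq_spinSector, partitionFn_spinSector_hubbardTorusTT'_eq_rect, ← hLx, ← hLy]
  rw [hsq, hK, typeEntropy_smul S m hsum R] at hfin
  -- bookkeeping: `L² = R q a b`, `Σ (R m_s) log z_s = R Σ m_s log z_s`, error term ≤ ε L²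
  have hL2 : (Ls j : ℝ) ^ 2 = (R : ℝ) * q * a * b := by
    have : (Ls j : ℝ) * (Ls j : ℝ) = ((Kx * a : ℕ) : ℝ) * ((Ky * b : ℕ) : ℝ) := by rw [← hLx, ← hLy]
    rw [sq, this]; push_cast
    have hK' : (Kx : ℝ) * Ky = R * q := by exact_mod_cast hK
    calc (Kx : ℝ) * a * (Ky * b) = (Kx * Ky) * a * b := by ring
      _ = R * q * a * b := by rw [hK']
  have hzsum : ∑ s ∈ S, ((R * m s : ℕ) : ℝ) * Real.log (z s) = (R : ℝ) * ∑ s ∈ S, (m s : ℝ) * Real.log (z s) := by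
    rw [Finset.mul_sum]; exact Finset.sum_congr rfl fun s _ => by push_cast; ring
  rw [hzsum] at hfin
  have hqab : (0 : ℝ) < (q : ℝ) * a * b := by
    have : (0:ℝ) < q := by exact_mod_cast hq
    have : (0:ℝ) < a := by exact_mod_cast ha
    have : (0:ℝ) < b := by exact_mod_cast hb
    positivity
  have hRq : ((R * q : ℕ) : ℝ) + 1 ≤ (Ls j : ℝ) ^ 2 + 1 := by
    rw [hL2]; push_cast
    have : (R : ℝ) * q ≤ R * q * a * b := by
      have hR0 : (0 : ℝ) ≤ (R : ℝ) * q := by positivity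
      have ha1 : (1 : ℝ) ≤ a := by exact_mod_cast ha
      have hb1 : (1 : ℝ) ≤ b := by exact_mod_cast hb
      nlinarith [mul_le_mul ha1 hb1 zero_le_one (zero_le_one.trans ha1)]
    linarith
  have herr : (S.card : ℝ) * Real.log (((R * q : ℕ) : ℝ) + 1) ≤ ε * (Ls j : ℝ) ^ 2 := by
    refine le_trans (mul_le_mul_of_nonneg_left (Real.log_le_log (by positivity) hRq) (Nat.cast_nonneg _)) hjε
  -- conclude
  have key : (((q : ℝ) * Real.log q - ∑ s ∈ S, (m s : ℝ) * Real.log (m s) +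
      ∑ s ∈ S, (m s : ℝ) * Real.log (z s)) / ((q : ℝ) * a * b)) * (Ls j : ℝ) ^ 2 =
      (R : ℝ) * ((q : ℝ) * Real.log q - ∑ s ∈ S, (m s : ℝ) * Real.log (m s)) +
        (R : ℝ) * ∑ s ∈ S, (m s : ℝ) * Real.log (z s) := by
    rw [hL2]
    field_simp
  rw [sub_mul, key]
  linarith [hfin, herr]

end InfVolFermionState

end Literature.MathematicalPhysics.QuantumLattice

end
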